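import Literature.NumberTheory.Irrationality.Fischler2015.NesterenkoCriterionVectors
import HarnessLib

/-!
# Fischler 2015: Corollary 1 from Theorem 1 (the printed deduction, proved)

Topic `Literature/NumberTheory/Irrationality/Fischler2015`. PROOFS ONLY (no definition, no statement; net debt 0):
`NesterenkoCriterionVectors.lean` types Theorem 1 (the rank of `(1,0), (0,1), (ζ(i), C(i+1,2)ζ(i+2))_{i odd ≤ a}`
is `≥ (2 log a/(1+log 2))(1+o(1))`) and Corollary 1 (`n₁(a) + n₂(a) ≥` the same bound) of S. Fischler,
*Nesterenko's criterion when vectors are linearly independent* / the vectors paper [Fischler2015Vectors], as two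
independent named facts; the source deduces the corollary from the theorem by counting. This file proves that
deduction on the typed statements (a kernel cross-check of the transcriptions `zetaPair`, `nOne`, `nTwo`):

* `finrank_span_zetaPair_le` — for odd `a`, the rank in Theorem 1 is `≤ 3 + n₁(a) + n₂(a)`: a vector
  `(ζ(i), C(i+1,2)ζ(i+2))` with `ζ(i), ζ(i+2) ∈ ℚ` lies in `span_ℚ{(1,0),(0,1)}`; the other indices have `ζ(i) ∉ ℚ`
  (`n₁(a)` of them) or `ζ(i) ∈ ℚ, ζ(i+2) ∉ ℚ` — at most `n₂(a) + 1` of them under `i ↦ i+2` (the `+1` is `i = a`,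
  which uses `a` odd); then `finrank(span) ≤ #`(spanning finset) (`finrank_span_finset_le_card`).
* `corollary1_of_theorem1 : theorem1 → corollary1` — Theorem 1 at `ε/2` absorbs the constant `3` as soon as
  `log a ≥ 3(1+log 2)/ε`.

HONEST FRAMING (cell pub-zeta5): systematic search; no irrationality claim unless certified. Bookkeeping between
RECORD statements about odd zeta values (Theorem 1 itself remains a named fact); nothing about `ζ(5)` specifically.
-/

noncomputable section

open Filter Finset

namespace Literature.NumberTheory.Irrationality.Fischler2015

open Literature.NumberTheory.Transcendental (zetaValue)

/-- **The dimension count behind Corollary 1**: for odd `a`, the `ℚ`-span of `(1,0), (0,1)` and the vectors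
`(ζ(i), C(i+1,2)ζ(i+2))`, `i` odd, `3 ≤ i ≤ a`, has dimension at most `3 + n₁(a) + n₂(a)` — a vector with `ζ(i)` and
`ζ(i+2)` both rational lies in the span of `(1,0), (0,1)`; the others are indexed by `i` with `ζ(i) ∉ ℚ` (`n₁(a)` of
them) or with `ζ(i) ∈ ℚ`, `ζ(i+2) ∉ ℚ` (at most `n₂(a) + 1` of them, via `i ↦ i + 2`, the `+1` accounting for `i = a`).
[cite: Fischler2015Vectors, Corollary 1 (deduced from Theorem 1, §1)] -/
theorem finrank_span_zetaPair_le {a : ℕ} (ha : Odd a) :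
    Module.finrank ℚ ↥(Submodule.span ℚ
        ({((1 : ℝ), (0 : ℝ)), ((0 : ℝ), (1 : ℝ))} ∪
          {v : ℝ × ℝ | ∃ i : ℕ, Odd i ∧ 3 ≤ i ∧ i ≤ a ∧ v = zetaPair i})) ≤ 3 + nOne a + nTwo a := by
  classical
  -- the index finsets
  set A₁ : Finset ℕ := (Finset.Icc 3 a).filter (fun i => Odd i ∧ Irrational (zetaValue i)) with hA₁
  set A₂ : Finset ℕ := (Finset.Icc 3 a).filter
    (fun i => Odd i ∧ ¬ Irrational (zetaValue i) ∧ Irrational (zetaValue (i + 2))) with hA₂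
  set N₂ : Finset ℕ := (Finset.Icc 5 a).filter
    (fun j => Odd j ∧ Irrational (zetaValue j) ∧ ¬ Irrational (zetaValue (j - 2))) with hN₂
  -- `n₁(a) = |A₁|`, `n₂(a) = |N₂|`
  have hn1 : nOne a = A₁.card := by
    rw [nOne, ← Set.ncard_coe_finset]
    congr 1
    ext i
    simp only [Set.mem_setOf_eq, hA₁, Finset.coe_filter, Finset.mem_Icc]
    tauto
  have hn2 : nTwo a = N₂.card := by
    rw [nTwo, ← Set.ncard_coe_finset]
    congr 1
    ext j
    simp only [Set.mem_setOf_eq, hN₂, Finset.coe_filter, Finset.mem_Icc]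
    tauto
  -- `|A₂| ≤ n₂(a) + 1` via `i ↦ i + 2`
  have hA₂card : A₂.card ≤ N₂.card + 1 := by
    have hinj : Function.Injective (fun i : ℕ => i + 2) := fun x y h => by simpa using h
    rw [← Finset.card_image_of_injective A₂ hinj]
    have hsub : A₂.image (fun i => i + 2) ⊆ insert (a + 2) N₂ := by
      intro j hj
      simp only [Finset.mem_image, hA₂, Finset.mem_filter, Finset.mem_Icc] at hj
      obtain ⟨i, ⟨⟨h3, hia⟩, hodd, hrat, hirr⟩, rfl⟩ := hj
      rw [Finset.mem_insert]
      by_cases hi : i = a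
      · exact Or.inl (by rw [hi])
      · refine Or.inr ?_
        simp only [hN₂, Finset.mem_filter, Finset.mem_Icc, Nat.add_sub_cancel]
        refine ⟨⟨by omega, ?_⟩, by obtain ⟨k, rfl⟩ := hodd; exact ⟨k + 1, by ring⟩, hirr, hrat⟩
        -- `i + 2 ≤ a`: `i < a`, both odd
        obtain ⟨k, rfl⟩ := hodd
        obtain ⟨m, rfl⟩ := ha
        omega
    exact (Finset.card_le_card hsub).trans (Finset.card_insert_le _ _)
  -- the finite spanning set
  set W : Finset (ℝ × ℝ) := {((1 : ℝ), (0 : ℝ)), ((0 : ℝ), (1 : ℝ))} ∪ (A₁.image zetaPair ∪ A₂.image zetaPair)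
    with hW
  have hWcard : W.card ≤ 2 + A₁.card + A₂.card := by
    calc W.card ≤ ({((1 : ℝ), (0 : ℝ)), ((0 : ℝ), (1 : ℝ))} : Finset (ℝ × ℝ)).card +
          (A₁.image zetaPair ∪ A₂.image zetaPair).card := Finset.card_union_le _ _
      _ ≤ 2 + ((A₁.image zetaPair).card + (A₂.image zetaPair).card) :=
          add_le_add (Finset.card_le_two) (Finset.card_union_le _ _)
      _ ≤ 2 + (A₁.card + A₂.card) := by gcongr <;> exact Finset.card_image_le
      _ = 2 + A₁.card + A₂.card := by ring
  haveI : Module.Finite ℚ (Submodule.span ℚ (W : Set (ℝ × ℝ))) :=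
    Module.Finite.span_of_finite ℚ W.finite_toSet
  -- the span of the printed set sits inside `span W`
  have hle : Submodule.span ℚ ({((1 : ℝ), (0 : ℝ)), ((0 : ℝ), (1 : ℝ))} ∪
      {v : ℝ × ℝ | ∃ i : ℕ, Odd i ∧ 3 ≤ i ∧ i ≤ a ∧ v = zetaPair i}) ≤ Submodule.span ℚ (W : Set (ℝ × ℝ)) := by
    refine Submodule.span_le.2 ?_
    have hB1 : ((1 : ℝ), (0 : ℝ)) ∈ (W : Set (ℝ × ℝ)) := by simp [hW]
    have hB2 : ((0 : ℝ), (1 : ℝ)) ∈ (W : Set (ℝ × ℝ)) := by simp [hW]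
    rintro v (hv | ⟨i, hodd, h3, hia, rfl⟩)
    · rcases hv with rfl | rfl
      · exact Submodule.subset_span hB1
      · exact Submodule.subset_span hB2
    · by_cases h1 : Irrational (zetaValue i)
      · refine Submodule.subset_span ?_
        simp only [hW, Finset.coe_union, Finset.coe_image, Set.mem_union, Set.mem_image, Finset.mem_coe, hA₁,
          Finset.mem_filter, Finset.mem_Icc]
        exact Or.inr (Or.inl ⟨i, ⟨⟨h3, hia⟩, hodd, h1⟩, rfl⟩)
      · by_cases h2 : Irrational (zetaValue (i + 2))
        · refine Submodule.subset_span ?_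
          simp only [hW, Finset.coe_union, Finset.coe_image, Set.mem_union, Set.mem_image, Finset.mem_coe, hA₂,
            Finset.mem_filter, Finset.mem_Icc]
          exact Or.inr (Or.inr ⟨i, ⟨⟨h3, hia⟩, hodd, h1, h2⟩, rfl⟩)
        · -- both rational: a rational combination of `(1,0)` and `(0,1)`
          obtain ⟨q₁, hq₁⟩ : ∃ q : ℚ, (q : ℝ) = zetaValue i := by
            unfold Irrational at h1; exact not_not.mp h1
          obtain ⟨q₂, hq₂⟩ : ∃ q : ℚ, (q : ℝ) = zetaValue (i + 2) := by
            unfold Irrational at h2; exact not_not.mp h2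
          have hv : zetaPair i = q₁ • ((1 : ℝ), (0 : ℝ)) + ((Nat.choose (i + 1) 2 : ℚ) * q₂) • ((0 : ℝ), (1 : ℝ)) := by
            rw [zetaPair, ← hq₁, ← hq₂]
            ext <;> simp [Rat.smul_def]
          rw [hv]
          exact Submodule.add_mem _ (Submodule.smul_mem _ _ (Submodule.subset_span hB1))
            (Submodule.smul_mem _ _ (Submodule.subset_span hB2))
  calc Module.finrank ℚ ↥(Submodule.span ℚ ({((1 : ℝ), (0 : ℝ)), ((0 : ℝ), (1 : ℝ))} ∪
          {v : ℝ × ℝ | ∃ i : ℕ, Odd i ∧ 3 ≤ i ∧ i ≤ a ∧ v = zetaPair i}))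
      ≤ Module.finrank ℚ (Submodule.span ℚ (W : Set (ℝ × ℝ))) := Submodule.finrank_mono hle
    _ ≤ W.card := finrank_span_finset_le_card W
    _ ≤ 2 + A₁.card + A₂.card := hWcard
    _ ≤ 3 + nOne a + nTwo a := by rw [hn1, hn2]; omega

/-- **Corollary 1 follows from Theorem 1** (the printed deduction, PROVED): by `finrank_span_zetaPair_le` the rank in
Theorem 1 is at most `3 + n₁(a) + n₂(a)`, and Theorem 1 at `ε/2` absorbs the constant `3` for `a` large.
[cite: Fischler2015Vectors, Corollary 1 (deduced from Theorem 1, §1)] -/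
theorem corollary1_of_theorem1 (h1 : theorem1) : corollary1 := by
  intro ε hε
  have hcpos : 0 < 1 + Real.log 2 := by have := Real.log_pos one_lt_two; linarith
  have hev := h1 (ε / 2) (by linarith)
  have hlarge : ∀ᶠ a : ℕ in atTop, 3 * (1 + Real.log 2) / ε ≤ Real.log a := by
    refine (eventually_ge_atTop ⌈Real.exp (3 * (1 + Real.log 2) / ε)⌉₊).mono fun a ha => ?_
    have h0 : Real.exp (3 * (1 + Real.log 2) / ε) ≤ a := le_trans (Nat.le_ceil _) (by exact_mod_cast ha)
    have := Real.log_le_log (Real.exp_pos _) h0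
    rwa [Real.log_exp] at this
  filter_upwards [hev, hlarge] with a ha hlog hodd
  have hfin := (ha hodd).trans (by exact_mod_cast finrank_span_zetaPair_le hodd :
    (Module.finrank ℚ ↥(Submodule.span ℚ ({((1 : ℝ), (0 : ℝ)), ((0 : ℝ), (1 : ℝ))} ∪
      {v : ℝ × ℝ | ∃ i : ℕ, Odd i ∧ 3 ≤ i ∧ i ≤ a ∧ v = zetaPair i})) : ℝ) ≤ (3 + nOne a + nTwo a : ℕ))
  push_cast at hfin
  -- `(ε/2)·(2 log a/(1+log 2)) ≥ 3`
  have h3 : 3 ≤ ε / 2 * (2 * Real.log a / (1 + Real.log 2)) := by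
    rw [div_le_iff₀ hε] at hlog
    have : ε / 2 * (2 * Real.log a / (1 + Real.log 2)) = ε * Real.log a / (1 + Real.log 2) := by ring
    rw [this, le_div_iff₀ hcpos]
    linarith
  have hsplit : (1 - ε) * (2 * Real.log a / (1 + Real.log 2)) =
      (1 - ε / 2) * (2 * Real.log a / (1 + Real.log 2)) - ε / 2 * (2 * Real.log a / (1 + Real.log 2)) := by ring
  linarith

end Literature.NumberTheory.Irrationality.Fischler2015
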